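import Summits.BirchSwinnertonDyer.BirchSwinnertonDyer.Theorems.ThetaPartnerAtTwoSignedMainConjectureCMTwoRankZeroLowerOffTwoOfCorePair
import HarnessLib

/-!
# Route `ThetaPartnerAtTwo` (TP2), crux K2R0P♭ `SignedMainConjectureCMTwoRankZeroOfPubOfFlat` (stmt-BirchSwinnertonDyer-26471; derived
# node K2r0P stmt-BirchSwinnertonDyer-24945), line `rankzero` v17: **the ONE stub (CORE♭-lower) SPLITS into TWO independent statements** —
# (S_PT) the `Λ`-adic Poitou–Tate deep half ON THE pairing (a pure Galois-cohomology statement: no zeta element, no `L`-function, no `𝔭'`)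
# and (S_ZETA) «Honda ∧ (ERL_pair) ∧ (g)^ι» (the CM twin of the K3 column's CORE_pair: Kato's class `s`, its explicit reciprocity law at finite
# level on THE layer pairing, and the CM `𝐇¹`-side comparison)

HONEST FRAMING (cell `pub/bsd-wall`, W-ALL row 1; width seat `bsd-wall-tp2-p2-w2` g4, `--supports` only). THEOREMS ONLY (no definition,
no named fact, no instance, no `sorry`); two implications between fully spelled statements; closes no item; the two hypotheses carry ALL the
research / published content; BSD is NOT proved by any of this.

## Why the split is lossless

In (CORE♭-lower) = `∃ g hg d s m, Honda(g,d) ∧ (PT♭)_layer(m) ∧ (ERL)(g,d,s) ∧ (g)^ι(s)` the clause (PT♭)_layer mentions NONE of `g, d, s` — only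
the universally bound `v, A, κ, I, pair` and its own exponent `m` — so the existential block factors as
`(∃ m, (PT♭)_layer(m)) ∧ (∃ g hg d s, Honda ∧ (ERL) ∧ (g)^ι)`. (The card `rankzero_v17.md` records «the three clauses share `s`»; for (PT♭) this
is not so, which is what makes a two-stub skeleton available without the pin «`s` = Kato's `z_A`».)

## What is here

* `offTwoLower_of_poitouTateDeepTwo_of_zetaErlLower` — (LDℓ)_A ⟸ (S_PT) ∧ (S_ZETA), where
  - (S_PT) := for every `v ∋ 2`, CM class member `A` (globally minimal, analytic rank `0`, `GoodSS A 2`, `a₂ = 0`), cyclotomic `(κ, γ)`, pinned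
    `I = 𝐇¹_Γ(T₂A)` and layer pairings `pair` whose residues are `CyclotomicLayer.tatePairingPk` ((P3) in LITERATURE names; (P1)(P2) are not
    needed as binders): `∃ m`, (PT♭)_layer(m) VERBATIM — every functional `z` on `E(ℚ_{2,∞}·ℚ_v)` whose Kummer values kill `res_v Sel⁺(A/ℚ_∞)`
    satisfies `2^m z(Q) = pair_n(proj_n x)(Q)` on `E⁺(ℚ_n·ℚ_v)` for some `x ∈ 𝐇¹` (Kobayashi (7.17)–(7.20) / Thm. 7.3: exactness of the `Λ`-adic
    Poitou–Tate sequence at `H¹_Iw(T)/H¹_{Iw,+}`, `H¹_+` := the exact annihilator of `E⁺ ⊗ ℚ₂/ℤ₂` (Def. 6.1); Milne ADT I Thm. 4.10 (b) in the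
    limit; at `p = 2` the real places and `E(ℚ_{n,w})[2^∞]` at the additive primes `w ∣ N` are absorbed by `2^m`);
  - (S_ZETA) := the binders of (CORE♭-lower) VERBATIM (Summits (P1)(P2)(P3)), then `∃ g hg d s`, Honda (L)(TR)(GEN)(GEN₀) ∧ (ERL_pair) ∧ (g)^ι —
    the K3 column's CORE_pair with «(ES) `IsEulerSystemClassTwo`» replaced by the CM `𝐇¹`-side comparison (g)^ι.
  Proof: reassemble (CORE♭-lower)_pair and apply `offTwoLower_of_coreLowerPair` (p623519).
* `offTwoLower_of_poitouTateDeepTwoGen_of_zetaErlLower` — the same with (S_PT) in its GENERAL form (every elliptic `A/ℚ`, no reduction / CM /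
  rank hypotheses), which trivially implies the class-restricted form; offered so the lead may register either text.

NET for the lead / pen (no ruling implied): a two-stub skeleton v18 = {`stub_poitouTateDeepHalfTwo` := (S_PT), `stub_zetaErlImcCMTwo` := (S_ZETA)}
composes by this file; (S_PT) is typer-fileable as ONE Literature fact on `CyclotomicLayer.tatePairingPk` + `Kato2004.IwasawaH1Data` (or provable:
Milne 4.10 (b) `SelmerComplement` + Shapiro + limits — design memo of this seat), independently of «CyclotomicTransport»; (S_ZETA) is the CM twin
of K3's CORE_pair and shares its (ERL_pair) conjunct verbatim.

References: [Kobayashi2003] Def. 6.1 (p. 10), Thm. 6.3 (p. 11), (7.17)–(7.21), Thm. 7.3 (pp. 12–13), (8.23), Prop. 8.25; [Kato2004Asterisque] Thm. 12.5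
(p. 222), Conj. 12.10 (p. 224), §15.12–15.16 (pp. 258–265), §17.13 (p. 280); [MilneADT2006] Ch. I Thm. 4.10 (b); [PerrinRiou1994Invent] §3.6.1;
[Sprung2012] Def. 3.1, Prop. 6.3–6.5; [JohnsonLeungKings2011] Thm. 5.2.
-/

set_option autoImplicit false
-- the Theorems namespace of this sub repeats the summit name by design (D-0017 nested layout)
set_option linter.dupNamespace false

noncomputable section

open scoped Classical NumberField MatrixGroups ModularForm

open NumberField IsDedekindDomain CongruenceSubgroup Polynomial

namespace Summit.BirchSwinnertonDyer.BirchSwinnertonDyer.Theorems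

namespace SignedLowerOffTwo

open Literature.NumberTheory.EllipticCurves Literature.NumberTheory.GaloisRepresentations
  WeierstrassCurve ZpExtension Literature.NumberTheory.EllipticCurves.Kobayashi2003
  Literature.NumberTheory.EllipticCurves.Module Literature.NumberTheory.EllipticCurves.Kato2004
  Literature.NumberTheory.EllipticCurves.Kato2004.EulerSystemValues
  Literature.NumberTheory.EllipticCurves.GreenbergSelmer Literature.NumberTheory.EllipticCurves.Sprung2012
  Literature.NumberTheory.EllipticCurves.ModularForms Literature.NumberTheory.EllipticCurves.Rank1Residual
  Summit.BirchSwinnertonDyer.Rank1Residual.Supersingular SignedKatoOffTwo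

/-- **(LDℓ)_A ⟸ (S_PT) ∧ (S_ZETA)** — the two-stub split of (CORE♭-lower) (see the module docstring). (S_PT): the `Λ`-adic Poitou–Tate deep
half on THE pairing, class-restricted binders, (P3) in Literature names, `∃ m` inside; (S_ZETA): Honda ∧ (ERL_pair) ∧ (g)^ι under the binders of
(CORE♭-lower) verbatim. Proof: `m` from (S_PT) (its (P3) through the `rfl` bridge `LayerPairing.layerPairingPk_weilTowerPk_eq_tatePairingPk`),
`g, d, s` and the three clauses from (S_ZETA), then `offTwoLower_of_coreLowerPair`. CONDITIONAL on the two hypotheses only; closes nothing by itself.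
[cite: Kobayashi2003, Def. 6.1 (p. 10), (7.17)–(7.21), Thm. 7.3 (pp. 12–13)] [cite: MilneADT2006, Ch. I, Thm. 4.10(b)]
[cite: Kato2004Asterisque, Thm. 12.5 (p. 222), Conj. 12.10 (p. 224), §17.13 (p. 280)] [cite: Sprung2012, Def. 3.1 (p. 1489), Prop. 6.3–6.5 (pp. 1496–1497)] -/
theorem offTwoLower_of_poitouTateDeepTwo_of_zetaErlLower
    (hPT : ∀ (v : HeightOneSpectrum (𝓞 ℚ)), ((2 : ℕ) : 𝓞 ℚ) ∈ v.asIdeal →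
      ∀ (A : WeierstrassCurve ℚ) [A.IsElliptic] [A.IsGloballyMinimal],
        A.HasCM → A.analyticRank = 0 → GoodSS A 2 → A.frobeniusTrace 2 = 0 →
        ∀ (κ : ZpExtension ℚ 2) (γ : Field.absoluteGaloisGroup ℚ),
          κ.IsCyclotomic → κ.IsTopGenerator γ →
        ∀ [ContinuousSMul ℤ_[2] (A.tateModule 2)] (I : Kato2004.IwasawaH1Data A 2 κ γ)
          (pair : ∀ n : ℕ, H1 (tateRep A 2) (κ.layerSubgroup n) →ₗ[ℤ_[2]]
            (localLayerPointsOfEmb κ (closureEmb (K := ℚ) (v.adicCompletion ℚ)) A n →+ ℤ_[2])),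
          -- (P3) in Literature names: `pair` IS the `T₂A`-adic local Tate pairing
          (∀ (n k : ℕ) (x : H1 (tateRep A 2) (κ.layerSubgroup n))
            (Q : localLayerPointsOfEmb κ (closureEmb (K := ℚ) (v.adicCompletion ℚ)) A n),
            PadicInt.toZModPow k (pair n x Q) = CyclotomicLayer.tatePairingPk A κ v n k x Q) →
        ∃ m : ℕ,
          (∀ z : localTowerPointsOfEmb κ (closureEmb (K := ℚ) (v.adicCompletion ℚ)) A →+ ℤ_[2],
            (∀ (t : A.subgroupH1 2 κ.kerSubgroup), t ∈ signedSelmerInfty A κ 1 →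
              ∀ (φ : contOneCocycles (discreteTopRep κ.kerSubgroup (A.geomPrimaryTorsion 2)))
                (Q : localPoints A (v.adicCompletion ℚ)) (k : ℕ), oneCocycleClass _ φ = t →
              ∀ hQ : 2 ^ k • Q ∈ (⨆ n, signedLocalPoints κ (v.adicCompletion ℚ) A 1 n),
              (∀ τ : localSubgroupOfEmb κ.kerSubgroup (closureEmb (K := ℚ) (v.adicCompletion ℚ)),
                pointsMapOfEmb A (closureEmb (K := ℚ) (v.adicCompletion ℚ))
                    ((φ.1 (resGalSubgroupOfEmb κ.kerSubgroup _ τ) : A.geomPrimaryTorsion 2) : A.geomPoints) =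
                  (τ : Field.absoluteGaloisGroup (v.adicCompletion ℚ)) • Q - Q) →
              (PadicInt.toZModPow k
                  (z ⟨2 ^ k • Q, SignedKatoOffTwo.KummerPoint.iSup_signedLocalPoints_le_localTowerPointsOfEmb A 2 κ 1 v hQ⟩)).val •
                ((((2 : ℚ) ^ k)⁻¹ : ℚ) : AddCircle (1 : ℚ)) = 0) →
            ∃ x : I.H, ∀ (n : ℕ) (Q : localPoints A (v.adicCompletion ℚ))
              (hQ : Q ∈ signedLocalPointsOfEmb κ (closureEmb (K := ℚ) (v.adicCompletion ℚ)) A 1 n),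
              (2 : ℤ_[2]) ^ m *
                  z ⟨Q, localLayerPointsOfEmb_le_localTowerPointsOfEmb κ _ A n (signedLocalPointsOfEmb_le κ _ A 1 n hQ)⟩ =
                pair n (I.proj n x) ⟨Q, signedLocalPointsOfEmb_le κ _ A 1 n hQ⟩))
    (hzeta : ∀ (v : HeightOneSpectrum (𝓞 ℚ)), ((2 : ℕ) : 𝓞 ℚ) ∈ v.asIdeal →
      ∀ (A : WeierstrassCurve ℚ) [A.IsElliptic] [A.IsGloballyMinimal],
        A.HasCM → A.analyticRank = 0 → GoodSS A 2 → A.frobeniusTrace 2 = 0 →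
        2 ∣ A.shaOrder * A.tamagawaProduct →
        ∀ (κ : ZpExtension ℚ 2) (γ : Field.absoluteGaloisGroup ℚ),
          κ.IsCyclotomic → κ.IsTopGenerator γ → IsCyclotomicVariable 2 γ →
        ∀ [NeZero (A.conductorNorm ℤ)] (f : CuspForm (Gamma0 (A.conductorNorm ℤ)) 2),
          IsNewformOf A f → ∀ (ϖ : ℚ), (ϖ : ℝ) * A.realPeriodRat = plusPeriod f →
        ∀ (Lplus Lminus : IwasawaAlgebra 2), IsPollackPair f 2 Lplus Lminus →
        ∀ [ContinuousSMul ℤ_[2] (A.tateModule 2)] (Y : A.FineSelmerDualData κ γ),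
        ∀ 𝔭' : PrimeSpectrum (IwasawaAlgebra 2), 𝔭'.asIdeal.height = 1 →
          PowerSeries.C (2 : ℤ_[2]) ∉ 𝔭'.asIdeal →
        ∀ (I : Kato2004.IwasawaH1Data A 2 κ γ)
          (pair : ∀ n : ℕ, H1 (tateRep A 2) (κ.layerSubgroup n) →ₗ[ℤ_[2]]
            (localLayerPointsOfEmb κ (closureEmb (K := ℚ) (v.adicCompletion ℚ)) A n →+ ℤ_[2])),
          -- (P1) projection formula
          (∀ (n : ℕ) (x : H1 (tateRep A 2) (κ.layerSubgroup (n + 1))) (Q : localPoints A (v.adicCompletion ℚ))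
            (hQ : Q ∈ localLayerPointsOfEmb κ (closureEmb (K := ℚ) (v.adicCompletion ℚ)) A n),
            pair n (layerCores (tateRep A 2) κ n x) ⟨Q, hQ⟩ =
              pair (n + 1) x ⟨Q, localLayerPointsOfEmb_mono κ (closureEmb (K := ℚ) (v.adicCompletion ℚ)) A (Nat.le_succ n) hQ⟩) →
          -- (P2) Galois invariance, for EVERY `g ∈ Γ_v`
          (∀ (n : ℕ) (g : Field.absoluteGaloisGroup (v.adicCompletion ℚ)) (y : H1 (tateRep A 2) (κ.layerSubgroup n))
            (Q : localPoints A (v.adicCompletion ℚ))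
            (hQ : Q ∈ localLayerPointsOfEmb κ (closureEmb (K := ℚ) (v.adicCompletion ℚ)) A n),
            pair n (conjMap (tateRep A 2).toTopRep (κ.layerSubgroup n) (resGalOfEmb (closureEmb (K := ℚ) (v.adicCompletion ℚ)) g) 1 y)
              ⟨g • Q, smul_mem_localLayerPointsOfEmb κ (closureEmb (K := ℚ) (v.adicCompletion ℚ)) A n g hQ⟩ = pair n y ⟨Q, hQ⟩) →
          -- (P3) residue clause: `pair` IS the `T₂A`-adic local Tate pairing (THE Weil pairings of the tree)
          (∀ (n k : ℕ) (x : H1 (tateRep A 2) (κ.layerSubgroup n))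
            (Q : localLayerPointsOfEmb κ (closureEmb (K := ℚ) (v.adicCompletion ℚ)) A n),
            PadicInt.toZModPow k (pair n x Q) =
              LayerPairing.layerPairingPk A κ v (LayerPairing.weilTowerPk A) (LayerPairing.weilTowerPk_pow A)
                (LayerPairing.weilTowerPk_add_left A) (LayerPairing.weilTowerPk_add_right A) (LayerPairing.weilTowerPk_smul A)
                n k x Q) →
        ∃ (g : Field.absoluteGaloisGroup (v.adicCompletion ℚ))
          (_ : κ.IsTopGenerator (resGalOfEmb (closureEmb (K := ℚ) (v.adicCompletion ℚ)) g))
          (d : ℕ → localPoints A (v.adicCompletion ℚ)) (s : I.H),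
          (∀ n, d n ∈ localLayerPointsOfEmb κ (closureEmb (K := ℚ) (v.adicCompletion ℚ)) A n) ∧
          (∀ n, localTraceOfEmb κ (closureEmb (K := ℚ) (v.adicCompletion ℚ)) A (n + 1) (n + 2) (d (n + 2)) = -d n) ∧
          (∀ n : ℕ, 1 ≤ n → ∀ P ∈ localLayerPointsOfEmb κ (closureEmb (K := ℚ) (v.adicCompletion ℚ)) A n,
            ∃ B ∈ AddSubgroup.closure (Set.range fun σ : Field.absoluteGaloisGroup (v.adicCompletion ℚ) ↦ σ • d n),
              ∃ P' ∈ localLayerPointsOfEmb κ (closureEmb (K := ℚ) (v.adicCompletion ℚ)) A (n - 1),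
              ∃ R ∈ localLayerPointsOfEmb κ (closureEmb (K := ℚ) (v.adicCompletion ℚ)) A n, P = B + P' + 2 • R) ∧
          (∀ P ∈ localLayerPointsOfEmb κ (closureEmb (K := ℚ) (v.adicCompletion ℚ)) A 0,
            ∃ a : ℤ, ∃ R ∈ localLayerPointsOfEmb κ (closureEmb (K := ℚ) (v.adicCompletion ℚ)) A 0, P = a • d 0 + 2 • R) ∧
          -- (ERL_pair) ON THE layer pairings: `ν·P_{n,d_n}(pair n (I.proj n s)) ≡ μ·θ_n (mod ω_n)` in `Λ ⊗ ℚ₂`, `μ, ν ∉ 𝔭'`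
          (∃ μ ν : IwasawaAlgebra 2, μ ∉ 𝔭'.asIdeal ∧ ν ∉ 𝔭'.asIdeal ∧
            ∀ n : ℕ, ∃ (m : ℕ) (q : IwasawaAlgebra 2),
              PowerSeries.C ((2 : ℚ_[2]) ^ m) *
                  (iwasawaToPowerSeries 2 μ * ((mazurTateElement f 2 n).map (algebraMap ℚ ℚ_[2]) : PowerSeries ℚ_[2]) -
                    iwasawaToPowerSeries 2 (ν * pairingSum A (localLayerPointsOfEmb κ (closureEmb (K := ℚ) (v.adicCompletion ℚ)) A n)
                      g n (d n) (pair n (I.proj n s)))) =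
                iwasawaToPowerSeries 2 (((cyclotomicOmega 2 n).map (Int.castRingHom ℤ_[2]) : PowerSeries ℤ_[2]) * q)) ∧
          -- (g)^ι the CM `𝐇¹`-side comparison, print-exact mixed-prime form
          lengthAt (IwasawaAlgebra 2) (I.H ⧸ Submodule.span (IwasawaAlgebra 2) {s}) 𝔭' ≤
            lengthAt (IwasawaAlgebra 2) Y.X (PrimeSpectrum.comap (IwasawaAlgebra.invol 2).toRingHom 𝔭')) :
    ∀ (A : WeierstrassCurve ℚ) [A.IsElliptic] [A.IsGloballyMinimal],
      A.HasCM → A.analyticRank = 0 → GoodSS A 2 → A.frobeniusTrace 2 = 0 →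
      2 ∣ A.shaOrder * A.tamagawaProduct →
      ∀ (κ : ZpExtension ℚ 2) (γ : Field.absoluteGaloisGroup ℚ),
        κ.IsCyclotomic → κ.IsTopGenerator γ → IsCyclotomicVariable 2 γ →
      ∀ [NeZero (A.conductorNorm ℤ)] (f : CuspForm (Gamma0 (A.conductorNorm ℤ)) 2),
        IsNewformOf A f → ∀ (ϖ : ℚ), (ϖ : ℝ) * A.realPeriodRat = plusPeriod f →
      ∀ (Lplus Lminus : IwasawaAlgebra 2), IsPollackPair f 2 Lplus Lminus →
      ∀ (D : SignedSelmerDualData A κ γ 1), Module.IsTorsion (IwasawaAlgebra 2) D.X →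
        ∀ 𝔭 : PrimeSpectrum (IwasawaAlgebra 2), 𝔭.asIdeal.height = 1 →
          PowerSeries.C (2 : ℤ_[2]) ∉ 𝔭.asIdeal →
          lengthAt (IwasawaAlgebra 2) (IwasawaAlgebra 2 ⧸ Ideal.span {kobayashiL 1 Lplus Lminus}) 𝔭 ≤
            lengthAt (IwasawaAlgebra 2) D.X 𝔭 := by
  refine offTwoLower_of_coreLowerPair fun v hv A _ _ hcm hr hss ha hz κ γ hκ hγ hcv _ f hf ϖ hϖ Lplus Lminus hPP _ Y 𝔭 h𝔭 hp𝔭 I pair hP1 hP2 hP3 ↦ ?_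
  obtain ⟨m, hPTm⟩ := hPT v hv A hcm hr hss ha κ γ hκ hγ I pair fun n k x Q ↦ by
    rw [← LayerPairing.layerPairingPk_weilTowerPk_eq_tatePairingPk]; exact hP3 n k x Q
  obtain ⟨g, hg, d, s, hL, hTR, hGEN, hGEN0, hERL, hIMC⟩ :=
    hzeta v hv A hcm hr hss ha hz κ γ hκ hγ hcv f hf ϖ hϖ Lplus Lminus hPP Y 𝔭 h𝔭 hp𝔭 I pair hP1 hP2 hP3
  exact ⟨g, hg, d, s, m, hL, hTR, hGEN, hGEN0, hPTm, hERL, hIMC⟩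

/-- **(LDℓ)_A ⟸ (S_PT)_gen ∧ (S_ZETA)** — as `offTwoLower_of_poitouTateDeepTwo_of_zetaErlLower` with the Poitou–Tate statement in GENERAL
form (every elliptic `A/ℚ`, every cyclotomic datum; no CM / rank / reduction hypotheses), which specialises to the class-restricted (S_PT).
CONDITIONAL on the two hypotheses only; closes nothing by itself. [cite: Kobayashi2003, (7.17)–(7.21), Thm. 7.3 (pp. 12–13)]
[cite: MilneADT2006, Ch. I, Thm. 4.10(b)] [cite: PerrinRiou1994Invent, §3.6.1] -/
theorem offTwoLower_of_poitouTateDeepTwoGen_of_zetaErlLower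
    (hPT : ∀ (v : HeightOneSpectrum (𝓞 ℚ)), ((2 : ℕ) : 𝓞 ℚ) ∈ v.asIdeal →
      ∀ (A : WeierstrassCurve ℚ) [A.IsElliptic],
        ∀ (κ : ZpExtension ℚ 2) (γ : Field.absoluteGaloisGroup ℚ),
          κ.IsCyclotomic → κ.IsTopGenerator γ →
        ∀ [ContinuousSMul ℤ_[2] (A.tateModule 2)] (I : Kato2004.IwasawaH1Data A 2 κ γ)
          (pair : ∀ n : ℕ, H1 (tateRep A 2) (κ.layerSubgroup n) →ₗ[ℤ_[2]]
            (localLayerPointsOfEmb κ (closureEmb (K := ℚ) (v.adicCompletion ℚ)) A n →+ ℤ_[2])),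
          -- (P3) in Literature names: `pair` IS the `T₂A`-adic local Tate pairing
          (∀ (n k : ℕ) (x : H1 (tateRep A 2) (κ.layerSubgroup n))
            (Q : localLayerPointsOfEmb κ (closureEmb (K := ℚ) (v.adicCompletion ℚ)) A n),
            PadicInt.toZModPow k (pair n x Q) = CyclotomicLayer.tatePairingPk A κ v n k x Q) →
        ∃ m : ℕ,
          (∀ z : localTowerPointsOfEmb κ (closureEmb (K := ℚ) (v.adicCompletion ℚ)) A →+ ℤ_[2],
            (∀ (t : A.subgroupH1 2 κ.kerSubgroup), t ∈ signedSelmerInfty A κ 1 →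
              ∀ (φ : contOneCocycles (discreteTopRep κ.kerSubgroup (A.geomPrimaryTorsion 2)))
                (Q : localPoints A (v.adicCompletion ℚ)) (k : ℕ), oneCocycleClass _ φ = t →
              ∀ hQ : 2 ^ k • Q ∈ (⨆ n, signedLocalPoints κ (v.adicCompletion ℚ) A 1 n),
              (∀ τ : localSubgroupOfEmb κ.kerSubgroup (closureEmb (K := ℚ) (v.adicCompletion ℚ)),
                pointsMapOfEmb A (closureEmb (K := ℚ) (v.adicCompletion ℚ))
                    ((φ.1 (resGalSubgroupOfEmb κ.kerSubgroup _ τ) : A.geomPrimaryTorsion 2) : A.geomPoints) =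
                  (τ : Field.absoluteGaloisGroup (v.adicCompletion ℚ)) • Q - Q) →
              (PadicInt.toZModPow k
                  (z ⟨2 ^ k • Q, SignedKatoOffTwo.KummerPoint.iSup_signedLocalPoints_le_localTowerPointsOfEmb A 2 κ 1 v hQ⟩)).val •
                ((((2 : ℚ) ^ k)⁻¹ : ℚ) : AddCircle (1 : ℚ)) = 0) →
            ∃ x : I.H, ∀ (n : ℕ) (Q : localPoints A (v.adicCompletion ℚ))
              (hQ : Q ∈ signedLocalPointsOfEmb κ (closureEmb (K := ℚ) (v.adicCompletion ℚ)) A 1 n),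
              (2 : ℤ_[2]) ^ m *
                  z ⟨Q, localLayerPointsOfEmb_le_localTowerPointsOfEmb κ _ A n (signedLocalPointsOfEmb_le κ _ A 1 n hQ)⟩ =
                pair n (I.proj n x) ⟨Q, signedLocalPointsOfEmb_le κ _ A 1 n hQ⟩))
    (hzeta : ∀ (v : HeightOneSpectrum (𝓞 ℚ)), ((2 : ℕ) : 𝓞 ℚ) ∈ v.asIdeal →
      ∀ (A : WeierstrassCurve ℚ) [A.IsElliptic] [A.IsGloballyMinimal],
        A.HasCM → A.analyticRank = 0 → GoodSS A 2 → A.frobeniusTrace 2 = 0 →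
        2 ∣ A.shaOrder * A.tamagawaProduct →
        ∀ (κ : ZpExtension ℚ 2) (γ : Field.absoluteGaloisGroup ℚ),
          κ.IsCyclotomic → κ.IsTopGenerator γ → IsCyclotomicVariable 2 γ →
        ∀ [NeZero (A.conductorNorm ℤ)] (f : CuspForm (Gamma0 (A.conductorNorm ℤ)) 2),
          IsNewformOf A f → ∀ (ϖ : ℚ), (ϖ : ℝ) * A.realPeriodRat = plusPeriod f →
        ∀ (Lplus Lminus : IwasawaAlgebra 2), IsPollackPair f 2 Lplus Lminus →
        ∀ [ContinuousSMul ℤ_[2] (A.tateModule 2)] (Y : A.FineSelmerDualData κ γ),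
        ∀ 𝔭' : PrimeSpectrum (IwasawaAlgebra 2), 𝔭'.asIdeal.height = 1 →
          PowerSeries.C (2 : ℤ_[2]) ∉ 𝔭'.asIdeal →
        ∀ (I : Kato2004.IwasawaH1Data A 2 κ γ)
          (pair : ∀ n : ℕ, H1 (tateRep A 2) (κ.layerSubgroup n) →ₗ[ℤ_[2]]
            (localLayerPointsOfEmb κ (closureEmb (K := ℚ) (v.adicCompletion ℚ)) A n →+ ℤ_[2])),
          -- (P1) projection formula
          (∀ (n : ℕ) (x : H1 (tateRep A 2) (κ.layerSubgroup (n + 1))) (Q : localPoints A (v.adicCompletion ℚ))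
            (hQ : Q ∈ localLayerPointsOfEmb κ (closureEmb (K := ℚ) (v.adicCompletion ℚ)) A n),
            pair n (layerCores (tateRep A 2) κ n x) ⟨Q, hQ⟩ =
              pair (n + 1) x ⟨Q, localLayerPointsOfEmb_mono κ (closureEmb (K := ℚ) (v.adicCompletion ℚ)) A (Nat.le_succ n) hQ⟩) →
          -- (P2) Galois invariance, for EVERY `g ∈ Γ_v`
          (∀ (n : ℕ) (g : Field.absoluteGaloisGroup (v.adicCompletion ℚ)) (y : H1 (tateRep A 2) (κ.layerSubgroup n))
            (Q : localPoints A (v.adicCompletion ℚ))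
            (hQ : Q ∈ localLayerPointsOfEmb κ (closureEmb (K := ℚ) (v.adicCompletion ℚ)) A n),
            pair n (conjMap (tateRep A 2).toTopRep (κ.layerSubgroup n) (resGalOfEmb (closureEmb (K := ℚ) (v.adicCompletion ℚ)) g) 1 y)
              ⟨g • Q, smul_mem_localLayerPointsOfEmb κ (closureEmb (K := ℚ) (v.adicCompletion ℚ)) A n g hQ⟩ = pair n y ⟨Q, hQ⟩) →
          -- (P3) residue clause: `pair` IS the `T₂A`-adic local Tate pairing (THE Weil pairings of the tree)
          (∀ (n k : ℕ) (x : H1 (tateRep A 2) (κ.layerSubgroup n))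
            (Q : localLayerPointsOfEmb κ (closureEmb (K := ℚ) (v.adicCompletion ℚ)) A n),
            PadicInt.toZModPow k (pair n x Q) =
              LayerPairing.layerPairingPk A κ v (LayerPairing.weilTowerPk A) (LayerPairing.weilTowerPk_pow A)
                (LayerPairing.weilTowerPk_add_left A) (LayerPairing.weilTowerPk_add_right A) (LayerPairing.weilTowerPk_smul A)
                n k x Q) →
        ∃ (g : Field.absoluteGaloisGroup (v.adicCompletion ℚ))
          (_ : κ.IsTopGenerator (resGalOfEmb (closureEmb (K := ℚ) (v.adicCompletion ℚ)) g))
          (d : ℕ → localPoints A (v.adicCompletion ℚ)) (s : I.H),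
          (∀ n, d n ∈ localLayerPointsOfEmb κ (closureEmb (K := ℚ) (v.adicCompletion ℚ)) A n) ∧
          (∀ n, localTraceOfEmb κ (closureEmb (K := ℚ) (v.adicCompletion ℚ)) A (n + 1) (n + 2) (d (n + 2)) = -d n) ∧
          (∀ n : ℕ, 1 ≤ n → ∀ P ∈ localLayerPointsOfEmb κ (closureEmb (K := ℚ) (v.adicCompletion ℚ)) A n,
            ∃ B ∈ AddSubgroup.closure (Set.range fun σ : Field.absoluteGaloisGroup (v.adicCompletion ℚ) ↦ σ • d n),
              ∃ P' ∈ localLayerPointsOfEmb κ (closureEmb (K := ℚ) (v.adicCompletion ℚ)) A (n - 1),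
              ∃ R ∈ localLayerPointsOfEmb κ (closureEmb (K := ℚ) (v.adicCompletion ℚ)) A n, P = B + P' + 2 • R) ∧
          (∀ P ∈ localLayerPointsOfEmb κ (closureEmb (K := ℚ) (v.adicCompletion ℚ)) A 0,
            ∃ a : ℤ, ∃ R ∈ localLayerPointsOfEmb κ (closureEmb (K := ℚ) (v.adicCompletion ℚ)) A 0, P = a • d 0 + 2 • R) ∧
          -- (ERL_pair) ON THE layer pairings: `ν·P_{n,d_n}(pair n (I.proj n s)) ≡ μ·θ_n (mod ω_n)` in `Λ ⊗ ℚ₂`, `μ, ν ∉ 𝔭'`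
          (∃ μ ν : IwasawaAlgebra 2, μ ∉ 𝔭'.asIdeal ∧ ν ∉ 𝔭'.asIdeal ∧
            ∀ n : ℕ, ∃ (m : ℕ) (q : IwasawaAlgebra 2),
              PowerSeries.C ((2 : ℚ_[2]) ^ m) *
                  (iwasawaToPowerSeries 2 μ * ((mazurTateElement f 2 n).map (algebraMap ℚ ℚ_[2]) : PowerSeries ℚ_[2]) -
                    iwasawaToPowerSeries 2 (ν * pairingSum A (localLayerPointsOfEmb κ (closureEmb (K := ℚ) (v.adicCompletion ℚ)) A n)
                      g n (d n) (pair n (I.proj n s)))) =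
                iwasawaToPowerSeries 2 (((cyclotomicOmega 2 n).map (Int.castRingHom ℤ_[2]) : PowerSeries ℤ_[2]) * q)) ∧
          -- (g)^ι the CM `𝐇¹`-side comparison, print-exact mixed-prime form
          lengthAt (IwasawaAlgebra 2) (I.H ⧸ Submodule.span (IwasawaAlgebra 2) {s}) 𝔭' ≤
            lengthAt (IwasawaAlgebra 2) Y.X (PrimeSpectrum.comap (IwasawaAlgebra.invol 2).toRingHom 𝔭')) :
    ∀ (A : WeierstrassCurve ℚ) [A.IsElliptic] [A.IsGloballyMinimal],
      A.HasCM → A.analyticRank = 0 → GoodSS A 2 → A.frobeniusTrace 2 = 0 →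
      2 ∣ A.shaOrder * A.tamagawaProduct →
      ∀ (κ : ZpExtension ℚ 2) (γ : Field.absoluteGaloisGroup ℚ),
        κ.IsCyclotomic → κ.IsTopGenerator γ → IsCyclotomicVariable 2 γ →
      ∀ [NeZero (A.conductorNorm ℤ)] (f : CuspForm (Gamma0 (A.conductorNorm ℤ)) 2),
        IsNewformOf A f → ∀ (ϖ : ℚ), (ϖ : ℝ) * A.realPeriodRat = plusPeriod f →
      ∀ (Lplus Lminus : IwasawaAlgebra 2), IsPollackPair f 2 Lplus Lminus →
      ∀ (D : SignedSelmerDualData A κ γ 1), Module.IsTorsion (IwasawaAlgebra 2) D.X →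
        ∀ 𝔭 : PrimeSpectrum (IwasawaAlgebra 2), 𝔭.asIdeal.height = 1 →
          PowerSeries.C (2 : ℤ_[2]) ∉ 𝔭.asIdeal →
          lengthAt (IwasawaAlgebra 2) (IwasawaAlgebra 2 ⧸ Ideal.span {kobayashiL 1 Lplus Lminus}) 𝔭 ≤
            lengthAt (IwasawaAlgebra 2) D.X 𝔭 :=
  offTwoLower_of_poitouTateDeepTwo_of_zetaErlLower
    (fun v hv A _ _ _ _ _ _ κ γ hκ hγ _ I pair hP3 ↦ hPT v hv A κ γ hκ hγ I pair hP3) hzeta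

end SignedLowerOffTwo

end Summit.BirchSwinnertonDyer.BirchSwinnertonDyer.Theorems

end
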